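import Mathlib

/-!
# The RP interpolation is a function of `G` alone (stub `rpInterpolation_unique`)

Used by line `Sketch` (canonical-lift spine, seat c1) of the crux `CriticalTwoPointGSM`
(stmt-CriticalPhenomena-8365). There the critical two-point function of the nearest-neighbour Ising
model on `ℤ³` is represented jointly as `G(n, z) = ∫ λ^{|n|} cos(k·z) dρ(λ, k)` (`n ∈ ℤ`, `z ∈ ℤ²`) for a
finite measure `ρ` on `ℝ³` carried by the box `[0,1]×[-π,π]²` (coordinates `p : Fin 3 → ℝ`, `p 0 = λ`,
`(p 1, p 2) = k`), and the physical stub `rpInterpolatedGSM` speaks about the reflection-positive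
interpolation `t ↦ ∫ λ^t cos(k·z) dρ` (`t ≥ 0` real) of such a representation. The representing
measure `ρ` is not unique (`cos(k·z)` is even in `k`), but the interpolation is:

**Theorem `rpInterpolation_unique`.** Two finite measures `ρ, ρ'` on `ℝ³` carried by the box with the
same joint moments `∫ λ^{|n|} cos(k·z)` (all `n ∈ ℤ`, `z ∈ ℤ²`) satisfy
`∫ λ^t cos(k·z) dρ = ∫ λ^t cos(k·z) dρ'` for every real `t ≥ 0` and every `z ∈ ℤ²`.

*Proof* (weighted Hausdorff determinacy). Fix `z` and the weight `c(p) = cos(k·z)` (continuous,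
`|c| ≤ 1`). Equality of the weighted moments `∫ λⁿ c dρ = ∫ λⁿ c dρ'` (`n ∈ ℕ`, the hypothesis at
`(n : ℤ)`) gives by linearity `∫ q(λ) c dρ = ∫ q(λ) c dρ'` for every real polynomial `q`; since the
`λ`-coordinate lives in `[0,1]` almost everywhere for both measures, the Weierstrass approximation
theorem on `[0,1]` (`exists_polynomial_near_of_continuousOn`) upgrades this to every continuous `g` in
place of `q` (an `ε`-argument against the two finite total masses), in particular to `g(λ) = λ^t`,
which is continuous on `ℝ` for `t ≥ 0` (`Real.continuous_rpow_const`). This is the argument of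
`Literature.MeasureTheory.Integral.measure_eq_of_moments_eq_of_Icc` run with the signed weight `c`
(Feller, *An Introduction to Probability Theory and its Applications* II, VII.3; folklore); no
push-forward or Jordan decomposition is needed. Nothing else is in this file.
-/

noncomputable section

open MeasureTheory Filter Topology
open scoped BigOperators

namespace Summit.CriticalPhenomena.Ising3DConformalLimit.Theorems

namespace CriticalTwoPointGSMJs.RpInterpolationUnique

open Set Polynomial

/-- Almost everywhere with respect to a measure on `ℝ³` carried by the box `[0,1]×[-π,π]²`, the first
coordinate lies in `[0,1]`. -/
theorem ae_apply_zero_mem_Icc {ν : Measure (Fin 3 → ℝ)}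
    (hν : ν {p | 0 ≤ p 0 ∧ p 0 ≤ 1 ∧ ∀ j : Fin 2, -Real.pi ≤ p j.succ ∧ p j.succ ≤ Real.pi}ᶜ = 0) :
    ∀ᵐ p ∂ν, p 0 ∈ Icc (0 : ℝ) 1 := by
  filter_upwards [(mem_ae_iff.2 hν : {p : Fin 3 → ℝ | 0 ≤ p 0 ∧ p 0 ≤ 1 ∧
    ∀ j : Fin 2, -Real.pi ≤ p j.succ ∧ p j.succ ≤ Real.pi} ∈ ae ν)] with p hp
  exact ⟨hp.1, hp.2.1⟩

/-- For `g : ℝ → ℝ` continuous and a continuous weight `c` on `ℝ³` with `|c| ≤ 1`, the function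
`p ↦ g(p 0) c(p)` is integrable against every finite measure on `ℝ³` carried by the box
`[0,1]×[-π,π]²` (it is measurable and a.e. bounded by `max_{[0,1]} |g|`). -/
theorem integrable_comp_apply_zero_mul {ν : Measure (Fin 3 → ℝ)} [IsFiniteMeasure ν]
    (hν : ν {p | 0 ≤ p 0 ∧ p 0 ≤ 1 ∧ ∀ j : Fin 2, -Real.pi ≤ p j.succ ∧ p j.succ ≤ Real.pi}ᶜ = 0)
    {c : (Fin 3 → ℝ) → ℝ} (hc : Continuous c) (hc1 : ∀ p, |c p| ≤ 1)
    {g : ℝ → ℝ} (hg : Continuous g) :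
    Integrable (fun p => g (p 0) * c p) ν := by
  obtain ⟨B, hB⟩ :=
    isCompact_Icc.exists_bound_of_continuousOn (hg.continuousOn (s := Icc (0 : ℝ) 1))
  refine Integrable.mono' (integrable_const B)
    ((hg.comp' (continuous_apply 0)).mul hc).aestronglyMeasurable ?_
  filter_upwards [ae_apply_zero_mem_Icc hν] with p hp
  rw [norm_mul]
  have h1 : ‖c p‖ ≤ 1 := (Real.norm_eq_abs (c p)).trans_le (hc1 p)
  calc ‖g (p 0)‖ * ‖c p‖ ≤ B * 1 :=
      mul_le_mul (hB _ hp) h1 (norm_nonneg _) ((norm_nonneg _).trans (hB _ hp))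
    _ = B := mul_one B

/-- Equality of the weighted moments `∫ λⁿ c dρ = ∫ λⁿ c dρ'` (`n ∈ ℕ`) passes by linearity to
`∫ q(λ) c dρ = ∫ q(λ) c dρ'` for every real polynomial `q`. -/
theorem integral_polynomial_mul_eq {ρ ρ' : Measure (Fin 3 → ℝ)} [IsFiniteMeasure ρ]
    [IsFiniteMeasure ρ']
    (hρ : ρ {p | 0 ≤ p 0 ∧ p 0 ≤ 1 ∧ ∀ j : Fin 2, -Real.pi ≤ p j.succ ∧ p j.succ ≤ Real.pi}ᶜ = 0)
    (hρ' : ρ' {p | 0 ≤ p 0 ∧ p 0 ≤ 1 ∧ ∀ j : Fin 2, -Real.pi ≤ p j.succ ∧ p j.succ ≤ Real.pi}ᶜ = 0)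
    {c : (Fin 3 → ℝ) → ℝ} (hc : Continuous c) (hc1 : ∀ p, |c p| ≤ 1)
    (hmom : ∀ n : ℕ, ∫ p, (p 0) ^ n * c p ∂ρ = ∫ p, (p 0) ^ n * c p ∂ρ') (q : ℝ[X]) :
    ∫ p, q.eval (p 0) * c p ∂ρ = ∫ p, q.eval (p 0) * c p ∂ρ' := by
  induction q using Polynomial.induction_on' with
  | add q₁ q₂ h₁ h₂ =>
    simp only [eval_add, add_mul]
    rw [integral_add (integrable_comp_apply_zero_mul hρ hc hc1 q₁.continuous)
        (integrable_comp_apply_zero_mul hρ hc hc1 q₂.continuous),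
      integral_add (integrable_comp_apply_zero_mul hρ' hc hc1 q₁.continuous)
        (integrable_comp_apply_zero_mul hρ' hc hc1 q₂.continuous), h₁, h₂]
  | monomial n a =>
    simp only [eval_monomial, mul_assoc]
    rw [integral_const_mul, integral_const_mul, hmom n]

/-- **Weighted Hausdorff determinacy on the box.** For finite measures `ρ, ρ'` on `ℝ³` carried by
`[0,1]×[-π,π]²` and a continuous weight `c` with `|c| ≤ 1`, equality of the weighted moments
`∫ λⁿ c dρ = ∫ λⁿ c dρ'` (`n ∈ ℕ`, `λ = p 0`) implies `∫ g(λ) c dρ = ∫ g(λ) c dρ'` for every continuous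
`g : ℝ → ℝ` (Weierstrass approximation of `g` on `[0,1]` by polynomials, and an `ε`-argument). -/
theorem integral_comp_apply_zero_mul_eq {ρ ρ' : Measure (Fin 3 → ℝ)} [IsFiniteMeasure ρ]
    [IsFiniteMeasure ρ']
    (hρ : ρ {p | 0 ≤ p 0 ∧ p 0 ≤ 1 ∧ ∀ j : Fin 2, -Real.pi ≤ p j.succ ∧ p j.succ ≤ Real.pi}ᶜ = 0)
    (hρ' : ρ' {p | 0 ≤ p 0 ∧ p 0 ≤ 1 ∧ ∀ j : Fin 2, -Real.pi ≤ p j.succ ∧ p j.succ ≤ Real.pi}ᶜ = 0)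
    {c : (Fin 3 → ℝ) → ℝ} (hc : Continuous c) (hc1 : ∀ p, |c p| ≤ 1)
    (hmom : ∀ n : ℕ, ∫ p, (p 0) ^ n * c p ∂ρ = ∫ p, (p 0) ^ n * c p ∂ρ') {g : ℝ → ℝ}
    (hg : Continuous g) :
    ∫ p, g (p 0) * c p ∂ρ = ∫ p, g (p 0) * c p ∂ρ' := by
  -- `ε`-approximation by a polynomial on `[0,1]`
  have key : ∀ ε : ℝ, 0 < ε →
      |∫ p, g (p 0) * c p ∂ρ - ∫ p, g (p 0) * c p ∂ρ'| ≤ ε * (ρ.real univ + ρ'.real univ) := by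
    intro ε hε
    obtain ⟨q, hq⟩ := exists_polynomial_near_of_continuousOn 0 1 g hg.continuousOn ε hε
    have e1 : ∫ p, g (p 0) * c p ∂ρ - ∫ p, g (p 0) * c p ∂ρ' =
        (∫ p, (g (p 0) - q.eval (p 0)) * c p ∂ρ) - ∫ p, (g (p 0) - q.eval (p 0)) * c p ∂ρ' := by
      simp only [sub_mul]
      rw [integral_sub (integrable_comp_apply_zero_mul hρ hc hc1 hg)
          (integrable_comp_apply_zero_mul hρ hc hc1 q.continuous),
        integral_sub (integrable_comp_apply_zero_mul hρ' hc hc1 hg)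
          (integrable_comp_apply_zero_mul hρ' hc hc1 q.continuous),
        integral_polynomial_mul_eq hρ hρ' hc hc1 hmom q]
      ring
    have bnd : ∀ (ν : Measure (Fin 3 → ℝ)) [IsFiniteMeasure ν],
        ν {p | 0 ≤ p 0 ∧ p 0 ≤ 1 ∧ ∀ j : Fin 2, -Real.pi ≤ p j.succ ∧ p j.succ ≤ Real.pi}ᶜ = 0 →
        |∫ p, (g (p 0) - q.eval (p 0)) * c p ∂ν| ≤ ε * ν.real univ := by
      intro ν _ hν
      rw [← Real.norm_eq_abs]
      refine norm_integral_le_of_norm_le_const ?_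
      filter_upwards [ae_apply_zero_mem_Icc hν] with p hp
      rw [norm_mul]
      have h1 : ‖c p‖ ≤ 1 := (Real.norm_eq_abs (c p)).trans_le (hc1 p)
      have h2 : ‖g (p 0) - q.eval (p 0)‖ ≤ ε := by
        rw [Real.norm_eq_abs, abs_sub_comm]
        exact (hq _ hp).le
      calc ‖g (p 0) - q.eval (p 0)‖ * ‖c p‖ ≤ ε * 1 := mul_le_mul h2 h1 (norm_nonneg _) hε.le
        _ = ε := mul_one ε
    rw [e1]
    calc |(∫ p, (g (p 0) - q.eval (p 0)) * c p ∂ρ) - ∫ p, (g (p 0) - q.eval (p 0)) * c p ∂ρ'|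
        ≤ |∫ p, (g (p 0) - q.eval (p 0)) * c p ∂ρ| + |∫ p, (g (p 0) - q.eval (p 0)) * c p ∂ρ'| :=
          abs_sub _ _
      _ ≤ ε * ρ.real univ + ε * ρ'.real univ := add_le_add (bnd ρ hρ) (bnd ρ' hρ')
      _ = ε * (ρ.real univ + ρ'.real univ) := by ring
  -- conclude: a nonnegative real below `ε K` for every `ε > 0` vanishes
  have hK : 0 ≤ ρ.real univ + ρ'.real univ := by positivity
  refine eq_of_abs_sub_eq_zero (le_antisymm (le_of_not_gt fun hcon => ?_) (abs_nonneg _))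
  have := key (|∫ p, g (p 0) * c p ∂ρ - ∫ p, g (p 0) * c p ∂ρ'| /
    (2 * (ρ.real univ + ρ'.real univ + 1))) (by positivity)
  rw [div_mul_eq_mul_div, le_div_iff₀ (by positivity)] at this
  nlinarith [abs_nonneg (∫ p, g (p 0) * c p ∂ρ - ∫ p, g (p 0) * c p ∂ρ')]

end CriticalTwoPointGSMJs.RpInterpolationUnique

open CriticalTwoPointGSMJs.RpInterpolationUnique in
/-- **The RP interpolation is a function of `G` alone (stub `rpInterpolation_unique`).** Two finite
measures on `ℝ³` carried by the box `[0,1]×[-π,π]²` with the same joint moments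
`∫ λ^{|n|} cos(k·z)` (all `n ∈ ℤ`, `z ∈ ℤ²`; `λ = p 0`, `k = (p 1, p 2)`) have the same RP
interpolations `∫ λ^t cos(k·z)` for every real `t ≥ 0` and every `z ∈ ℤ²`. Proof: weighted Hausdorff
determinacy `integral_comp_apply_zero_mul_eq` with the weight `c = cos(k·z)` (`|c| ≤ 1`) and the
continuous function `g(λ) = λ^t` (`Real.continuous_rpow_const`, `t ≥ 0`); the moment hypothesis is used
at `n ∈ ℕ ⊆ ℤ`. (Folklore; cf. Feller, *An Introduction to Probability Theory and its Applications*
II, VII.3, for the determinacy of the Hausdorff moment problem.) -/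
theorem rpInterpolation_unique : ∀ ρ ρ' : Measure (Fin 3 → ℝ), IsFiniteMeasure ρ → IsFiniteMeasure ρ' →
    ρ {p | 0 ≤ p 0 ∧ p 0 ≤ 1 ∧ ∀ j : Fin 2, -Real.pi ≤ p j.succ ∧ p j.succ ≤ Real.pi}ᶜ = 0 →
    ρ' {p | 0 ≤ p 0 ∧ p 0 ≤ 1 ∧ ∀ j : Fin 2, -Real.pi ≤ p j.succ ∧ p j.succ ≤ Real.pi}ᶜ = 0 →
    (∀ (n : ℤ) (z : Fin 2 → ℤ),
      ∫ p, (p 0) ^ n.natAbs * Real.cos (∑ j : Fin 2, p j.succ * (z j : ℝ)) ∂ρ =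
        ∫ p, (p 0) ^ n.natAbs * Real.cos (∑ j : Fin 2, p j.succ * (z j : ℝ)) ∂ρ') →
    ∀ t : ℝ, 0 ≤ t → ∀ z : Fin 2 → ℤ,
      ∫ p, (p 0) ^ t * Real.cos (∑ j : Fin 2, p j.succ * (z j : ℝ)) ∂ρ =
        ∫ p, (p 0) ^ t * Real.cos (∑ j : Fin 2, p j.succ * (z j : ℝ)) ∂ρ' := by
  intro ρ ρ' _ _ hρ hρ' hmom t ht z
  have hc : Continuous fun p : Fin 3 → ℝ => Real.cos (∑ j : Fin 2, p j.succ * (z j : ℝ)) :=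
    Real.continuous_cos.comp'
      (continuous_finsetSum _ fun j _ => (continuous_apply _).mul continuous_const)
  exact integral_comp_apply_zero_mul_eq hρ hρ'
    (c := fun p => Real.cos (∑ j : Fin 2, p j.succ * (z j : ℝ))) hc
    (fun p => Real.abs_cos_le_one _) (fun n => by simpa only [Int.natAbs_natCast] using hmom n z)
    (Real.continuous_rpow_const ht)

end Summit.CriticalPhenomena.Ising3DConformalLimit.Theorems

end
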